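import Literature.AlgebraicGeometry.Hyperkaehler.AutZeroCohomologyTransportOfChain
import Literature.AlgebraicGeometry.Hyperkaehler.FixedPointSchemeSplitAnalytification
import Literature.AlgebraicGeometry.Hyperkaehler.GeneralizedKummerTypeTranslationFixedPoints
import Literature.AlgebraicGeometry.Hyperkaehler.GeneralizedKummerFourTranslationFixedPoints
import Literature.AlgebraicGeometry.Hyperkaehler.GeneralizedKummerNaturalAutomorphisms
import HarnessLib

/-!
# Fixed points of `Γ(X)` on a variety of `Kum⁴`-type along a CHAIN of families of irreducible symplectic manifolds:
# the composition behind `F125X`, PROVED from the Hassett–Tschinkel fact down to the IHS-chain hypothesis and the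
# Kummer-end count

Layer `Literature/AlgebraicGeometry/Hyperkaehler`; companion of `AutZeroCohomologyTransportOfChain.lean` (the same
composition for the binder `T₄`).  The tree records binder #19 of the `Kum⁴` Hodge blueprint,
`HassettTschinkel2013_Oguiso2020_fixedPointScheme_translation_kum4Type` ("on every smooth projective `X` of
`Kum⁴`-type, for every `δ ∈ Γ(X) ∖ 1`, every fixed-point scheme of `⟨δ⟩` is `125` reduced points"), as a
PRINT-SYNTHESIS (file `GeneralizedKummerTypeTranslationFixedPoints`, steps (i)–(iv)), and PROVES its ENGINES
separately: the one-family transport of the fixed-point count of finite-order elements of `Aut°`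
(`Geometry.Hyperkaehler.HassettTschinkel2013_holAutZero_localSystem.forall_orderOf_ncard_fixedPoints_iff_of_family`,
steps (ii)+(iii) for one family, from the REFEREED fact `HassettTschinkel2013_holAutZero_localSystem`) and the
algebraic ends (`exists_fin_isColimit_cofan_of_isSmoothProjective`: a fixed-point scheme splits into `N` reduced points
once `analyticAut δ` has `N` fixed points, Conrad–Gabber–Prasad A.8.10 + GAGA; `exists_mulEquiv_autZero_holAutZero`:
`Aut₀(X) ≃* Aut°(X^an)`).  The COMPOSITION was missing ("the cell's engine files exist; the composition does not",
K5 audit `BINDERS.md` §#19 (E), glue G19).  This file composes them: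

* `HassettTschinkel2013_holAutZero_localSystem.forall_orderOf_ncard_fixedPoints_iff_of_chain` — the one-family
  statement propagated along `Relation.EqvGen` of the IHS-family step (induction: each step is an `iff`);
* **`hassettTschinkel2013_Oguiso2020_fixedPointScheme_translation_kum4Type_of_ihsChains`** — binder #19 FOLLOWS
  from: (a) the Hassett–Tschinkel fact; (b) `FloccariVaresco2024_autFixingH2H3_equiv_kumType` (`Γ(X) ≅ (ℤ/5)⁴`, so
  `δ ≠ 1` has order `5`); (c) the IHS-CHAIN hypothesis — every smooth projective `X` of `Kum⁴`-type is joined to an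
  analytification of a smooth projective `K⁴(A)` by a chain of proper holomorphic submersions all of whose fibres are
  irreducible symplectic (the printed meaning of "deformation of `K⁴(A)`"; the tree's `IsOfGeneralizedKummerType`
  allows arbitrary compact complex fibres — the located «IHS-chain» residual, the SAME hypothesis as in
  `hassettTschinkel2013_autZero_cohomologyTransport_kumType_of_ihsChains`); (d) the KUMMER-END COUNT — on (an
  analytification `N` of) `K⁴(A)` itself every element of `Aut°(N)` of order `5` has exactly `125` fixed points, a
  finite set.  (d) is Oguiso 2020 Prop. 3.6 ("The fixed locus `X^a` consists of `p³` connected components … each …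
  `K_{d−1}(A/⟨a⟩)`", `n = p = 5`, `d = 1`: `125` points) together with Boissière–Nieper-Wißkirchen–Sarti Cor. 3.3 (2) /
  Oguiso Thm. 1.2 (`Aut°(K⁴(A)) = T(5)·⟨ι⟩`: the elements of order `5` are the non-trivial translations, the coset of
  `ι` consisting of involutions) — in the tree: the scheme-theoretic record
  `Oguiso2020_fixedPointScheme_translation_generalizedKummerFour` + `BNWS2011_autTrivialOnH2_generalizedKummer` +
  `Foster2024_kummerTranslation_trivialOnH3` (file `GeneralizedKummerNaturalAutomorphisms`), short of the count of the
  `ℂ`-points of a split fixed-point scheme (`F ≅ ∐₁₂₅ Spec ℂ ⟹ #F(ℂ) = 125`, not yet a tree lemma) — so (d) is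
  kept as an explicit hypothesis in its printed (analytic) form, and NOT introduced as a named fact.

So the exact residual of the synthesis `F125X` is: the IHS-chain hypothesis (c) (shared with `T₄`) and the Kummer-end
count (d) in analytic form.  Everything here is proved; no named fact, definition, instance or notation is introduced;
nothing here asserts HC / HC_Kum4Type.

References: B. Hassett, Yu. Tschinkel, Mosc. Math. J. 13 (2013) §2 Thm. 2.1 and p. 6 [`HassettTschinkel2013`];
K. Oguiso, Nagoya Math. J. 239 (2020) Prop. 3.5–3.6, Thm. 1.2 [`Oguiso2020CohomologicallyTrivialKummer`]; S. Floccari,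
Compositio Math. 160 (2024) Lemma 2.2 (proof) [`Floccari2024`]; S. Floccari, M. Varesco (2025) §3
[`FloccariVaresco2024`]; B. Conrad, O. Gabber, G. Prasad, Prop. A.8.10 [`ConradGabberPrasad2015`]; J.-P. Serre, GAGA §2
[`SerreGAGA1956`]; K. Kodaira (2005) §2.3 [`Kodaira2005`].
-/

noncomputable section

open scoped Manifold ContDiff Topology
open CategoryTheory CategoryTheory.Limits Function Set
open Literature.Geometry.Kaehler
open Literature.Geometry.Hyperkaehler
open Literature.NumberTheory.Transcendental
open Literature.AlgebraicGeometry.Motives (SchemeOver ComplexPoints IsSmoothProjective AlgPoints)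
open Literature.AlgebraicGeometry.GroupActions

universe u

/-! ### Along a chain of IHS families (analytic; any universe) -/

namespace Literature.Geometry.Hyperkaehler

/-- **The fixed-point count of finite-order elements of `Aut°` is constant along a CHAIN of families of irreducible
symplectic manifolds**: if `X` and `Y` are joined by `Relation.EqvGen` of «fibres of one proper holomorphic
submersion over a connected base all of whose fibres are irreducible symplectic», then for `n ≥ 1` and `N`, every
`g ∈ Aut°(X)` of order `n` has exactly `N` fixed points (a finite set) iff every `g ∈ Aut°(Y)` of order `n` does
(the one-family theorem `forall_orderOf_ncard_fixedPoints_iff_of_family`, propagated: each step is an `iff`).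
[cite: HassettTschinkel2013, §2 Thm. 2.1 and p. 6 («the fixed-point loci carry over»)]
[cite: Floccari2024, §2 Lemma 2.2 (proof: «their fixed loci deform as well»)] [cite: Kodaira2005, §2.3 Def. 2.9] -/
theorem HassettTschinkel2013_holAutZero_localSystem.forall_orderOf_ncard_fixedPoints_iff_of_chain
    (h : HassettTschinkel2013_holAutZero_localSystem.{u}) {X Y : ComplexManifold.{u}}
    (hXY : Relation.EqvGen (fun X Y : ComplexManifold.{u} =>
      ∃ (𝒴 C : ComplexManifold.{u}) (ϖ : 𝒴 → C) (s t : C) (ι : X → 𝒴) (κ : Y → 𝒴),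
        T2Space 𝒴 ∧ SecondCountableTopology 𝒴 ∧ T2Space C ∧ SecondCountableTopology C ∧
          ConnectedSpace C ∧ IsProperHolomorphicSubmersion 𝒴.model C.model ϖ ∧
          IsFibreEmbedding X.model 𝒴.model ϖ s ι ∧ IsFibreEmbedding Y.model 𝒴.model ϖ t κ ∧
          ∀ c : C, ∃ (Z : ComplexManifold.{u}) (μ : Z → 𝒴),
            IsFibreEmbedding Z.model 𝒴.model ϖ c μ ∧ Z.IsIrreducibleSymplectic) X Y)
    {n : ℕ} (hn : 0 < n) (N : ℕ) :
    (∀ g : holAutZero X.model X, orderOf (g : X ≃ₜ X) = n →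
        {x : X | (g : X ≃ₜ X) x = x}.ncard = N ∧ {x : X | (g : X ≃ₜ X) x = x}.Finite) ↔
      (∀ g : holAutZero Y.model Y, orderOf (g : Y ≃ₜ Y) = n →
        {y : Y | (g : Y ≃ₜ Y) y = y}.ncard = N ∧ {y : Y | (g : Y ≃ₜ Y) y = y}.Finite) := by
  induction hXY with
  | rel X Y hstep => exact h.forall_orderOf_ncard_fixedPoints_iff_of_family hstep hn N
  | refl X => exact Iff.rfl
  | symm X Y _ ih => exact ih.symm
  | trans X Y Z _ _ ih₁ ih₂ => exact ih₁.trans ih₂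

end Literature.Geometry.Hyperkaehler

/-! ### The algebraic end at `X` and the composition -/

namespace Literature.AlgebraicGeometry.Hyperkaehler

/-- In `Γ(X) ≅ (ℤ/5)⁴` every element has `δ⁵ = 1`; hence a non-trivial `δ` has order `5`.
[cite: FloccariVaresco2024, §3 first paragraph (Γ_n ≅ (ℤ/(n+1))⁴)] -/
theorem orderOf_eq_five_of_autFixingH2H3_kum4Type (hFV : FloccariVaresco2024_autFixingH2H3_equiv_kumType)
    {X : SchemeOver ℂ} (hX : IsSmoothProjective 8 X) (hKum : IsOfGeneralizedKummerType 4 X)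
    (δ : autFixingH2H3 X) (hδ : δ ≠ 1) : orderOf δ = 5 := by
  obtain ⟨e⟩ := hFV 4 (by norm_num) hX hKum
  haveI : Fact (Nat.Prime 5) := ⟨by norm_num⟩
  refine orderOf_eq_prime ?_ hδ
  apply e.injective
  rw [map_pow, map_one]
  have h50 : ((5 : ℕ) : ZMod (4 + 1)) = 0 := ZMod.natCast_self (4 + 1)
  have h5 : ∀ v : Multiplicative (Fin 4 → ZMod (4 + 1)), v ^ 5 = 1 := fun v => by
    refine Multiplicative.toAdd.injective ?_
    rw [toAdd_pow, toAdd_one]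
    funext i
    rw [Pi.smul_apply, Pi.zero_apply, nsmul_eq_mul, h50, zero_mul]
  exact h5 (e δ)

/-- **G19 — `F125X` from Hassett–Tschinkel + IHS chains + the Kummer-end count.**  If (c) every smooth projective
`X` of `Kum⁴`-type is joined to an analytification of a smooth projective `K⁴(A)` (`A` an abelian surface) by a
chain of proper holomorphic submersions ALL OF WHOSE FIBRES ARE IRREDUCIBLE SYMPLECTIC, and (d) on such an
analytification `N` of `K⁴(A)` every element of `Aut°(N)` of order `5` has exactly `125` fixed points (a finite set)
— Oguiso 2020 Prop. 3.6 with BNWS Cor. 3.3 (2), analytic form — then, granted the Hassett–Tschinkel local-system fact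
(a) and `Γ(X) ≅ (ℤ/5)⁴` (b), the PRINT-SYNTHESIS fact
`HassettTschinkel2013_Oguiso2020_fixedPointScheme_translation_kum4Type` holds: for every `δ ∈ Γ(X) ∖ 1`, every
fixed-point scheme of `⟨δ⟩` is the coproduct of `125` copies of `Spec ℂ`.  Proof: `δ` has order `5` (b), so does
`analyticAut δ ∈ Aut°(X^an)` (GAGA end `exists_mulEquiv_autZero_holAutZero`); the count `125` travels from `N` to `X^an`
along the chain (`forall_orderOf_ncard_fixedPoints_iff_of_chain`); the fixed-point scheme then splits
(`exists_fin_isColimit_cofan_of_isSmoothProjective`, CGP A.8.10 + GAGA).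
[cite: HassettTschinkel2013, §2 Thm. 2.1 and p. 6] [cite: Oguiso2020CohomologicallyTrivialKummer, §3 Prop. 3.5–3.6 and Thm. 1.2]
[cite: Floccari2024, §2 Lemma 2.2 (proof)] [cite: ConradGabberPrasad2015, Prop. A.8.10(1)–(2)]
[cite: SerreGAGA1956, §2 Prop. 2 and §3 n°20] [cite: FloccariVaresco2024, §3 first paragraph] -/
theorem hassettTschinkel2013_Oguiso2020_fixedPointScheme_translation_kum4Type_of_ihsChains
    (h : Literature.Geometry.Hyperkaehler.HassettTschinkel2013_holAutZero_localSystem.{0})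
    (hFV : FloccariVaresco2024_autFixingH2H3_equiv_kumType)
    (hchain : ∀ ⦃X : SchemeOver ℂ⦄, IsSmoothProjective 8 X → IsOfGeneralizedKummerType 4 X →
      ∃ (A : Motives.AbelianVariety ℂ) (K : SchemeOver ℂ), A.dim = 2 ∧
        IsGeneralizedKummerVarietyOf 4 A K ∧ IsSmoothProjective 8 K ∧
        ∃ (M N : ComplexManifold.{0}) (φ : M → ComplexPoints X) (ψ : N → ComplexPoints K),
          IsAnalytification M.model X 8 φ ∧ IsAnalytification N.model K 8 ψ ∧
          Relation.EqvGen (fun X Y : ComplexManifold.{0} =>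
            ∃ (𝒴 C : ComplexManifold.{0}) (ϖ : 𝒴 → C) (s t : C) (ι : X → 𝒴) (κ : Y → 𝒴),
              T2Space 𝒴 ∧ SecondCountableTopology 𝒴 ∧ T2Space C ∧ SecondCountableTopology C ∧
                ConnectedSpace C ∧ IsProperHolomorphicSubmersion 𝒴.model C.model ϖ ∧
                IsFibreEmbedding X.model 𝒴.model ϖ s ι ∧ IsFibreEmbedding Y.model 𝒴.model ϖ t κ ∧
                ∀ c : C, ∃ (Z : ComplexManifold.{0}) (μ : Z → 𝒴),
                  IsFibreEmbedding Z.model 𝒴.model ϖ c μ ∧ Z.IsIrreducibleSymplectic) M N)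
    (hK : ∀ ⦃A : Motives.AbelianVariety ℂ⦄ ⦃K : SchemeOver ℂ⦄, A.dim = 2 → IsGeneralizedKummerVarietyOf 4 A K →
      IsSmoothProjective 8 K → ∀ (N : ComplexManifold.{0}) (ψ : N → ComplexPoints K),
        IsAnalytification N.model K 8 ψ →
          ∀ g : holAutZero N.model N, orderOf (g : N ≃ₜ N) = 5 →
            {y : N | (g : N ≃ₜ N) y = y}.ncard = 125 ∧ {y : N | (g : N ≃ₜ N) y = y}.Finite) :
    HassettTschinkel2013_Oguiso2020_fixedPointScheme_translation_kum4Type := by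
  intro X hX hKum δ hδ F j hF
  obtain ⟨A, K, hA, hKv, hKs, M, N, φ, ψ, hφ, hψ, hMN⟩ := hchain hX hKum
  -- the count at the Kummer end, transported along the chain to `M = X^an`
  have hPM := (h.forall_orderOf_ncard_fixedPoints_iff_of_chain hMN (by norm_num : 0 < 5) 125).2
    (hK hA hKv hKs N ψ hψ)
  -- `δ` has order `5`, and so does `analyticAut δ ∈ Aut°(M)`
  have hord : orderOf δ = 5 := orderOf_eq_five_of_autFixingH2H3_kum4Type hFV hX hKum δ hδ
  obtain ⟨ψX, hψX⟩ := exists_mulEquiv_autZero_holAutZero hX hφ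
  let δ₀ : autZero X := ⟨δ.val, δ.property.1⟩
  have hord₀ : orderOf δ₀ = 5 := by
    rw [← Subgroup.orderOf_coe, ← hord, ← Subgroup.orderOf_coe]
  have hordM : orderOf ((ψX δ₀ : holAutZero M.model M) : M ≃ₜ M) = 5 := by
    rw [Subgroup.orderOf_coe, MulEquiv.orderOf_eq, hord₀]
  obtain ⟨hN, -⟩ := hPM (ψX δ₀) hordM
  rw [hψX δ₀] at hN
  -- the fixed-point scheme splits into `125` reduced points
  have hfin : IsOfFinOrder δ.val := by
    rw [isOfFinOrder_iff_pow_eq_one]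
    refine ⟨5, by norm_num, ?_⟩
    have h5 : δ ^ 5 = 1 := by rw [← hord]; exact pow_orderOf_eq_one δ
    exact congrArg Subtype.val h5
  obtain ⟨x, -, hx⟩ := exists_fin_isColimit_cofan_of_isSmoothProjective hX hφ δ.val hfin (by norm_num) hN j hF
  exact ⟨x, hx⟩

/-! ### The Kummer-end count, from the scheme-theoretic records (K5 glue G19, second half) -/

/-- **The Kummer-end count (d), PROVED from the tree's records.**  On an analytification `N` of a smooth
projective generalized Kummer variety `K = K⁴(A)` of an abelian surface, every element `g ∈ Aut°(N)` of
order `5` has exactly `125` fixed points, a finite set.  Assembly: `g` is `analyticAut δ₀` for a unique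
`δ₀ ∈ Aut₀(K)` of order `5` (GAGA end `exists_mulEquiv_autZero_holAutZero`); an automorphism of `Kⁿ(A)`
acting trivially on `H²` is a Kummer translation or lies in the coset of natural involutions
(Boissière–Nieper-Wißkirchen–Sarti Cor. 3.3 (2) / Oguiso Thm. 1.2, record
`BNWS2011_autTrivialOnH2_generalizedKummer`; translations act trivially on `H³`, Foster / Oguiso (8),
record `Foster2024_kummerTranslation_trivialOnH3`), so `δ₀`, of odd order, lies in `Γ(K)`
(`mem_autFixingH2H3_of_trivialOnH2_of_not_orderOf_dvd_two`, with Beauville's translation action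
`HilbertScheme.translationAction`); by Oguiso Prop. 3.6 (record
`Oguiso2020_fixedPointScheme_translation_generalizedKummerFour`) a fixed-point scheme `F` of `⟨δ₀⟩`
(one exists, Conrad–Gabber–Prasad A.8.10(1), `K` being separated) splits as `∐₁₂₅ Spec ℂ`, hence has
exactly `125` `ℂ`-points (`Morphisms.natCard_hom_unit_eq_of_isColimit_cofan_fin`), and these are the
`δ₀`-fixed `ℂ`-points of `K` (A.8.10(1)), i.e. the fixed points of `analyticAut δ₀ = g` (GAGA §2 Prop. 2).
[cite: Oguiso2020CohomologicallyTrivialKummer, §3 Prop. 3.5–3.6 and Thm. 1.2]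
[cite: BoissiereNieperWisskirchenSarti2011, §3 Cor. 3.3 (2)] [cite: Foster2024, §3 Cor. 3.5 and App. A Thm. A.1(5)]
[cite: ConradGabberPrasad2015, Prop. A.8.10(1)] [cite: SerreGAGA1956, §2 Prop. 2 and §3 n°20] -/
theorem ncard_fixedPoints_holAutZero_generalizedKummerFour_of_pieces
    (h₁₉ : Oguiso2020_fixedPointScheme_translation_generalizedKummerFour)
    (h₂ : Foster2024_kummerTranslation_trivialOnH3) (h₃ : BNWS2011_autTrivialOnH2_generalizedKummer)
    ⦃A : Motives.AbelianVariety ℂ⦄ ⦃K : SchemeOver ℂ⦄ (hA : A.dim = 2) (hKv : IsGeneralizedKummerVarietyOf 4 A K)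
    (hKs : IsSmoothProjective 8 K) (N : ComplexManifold.{0}) (ψ : N → ComplexPoints K)
    (hψ : IsAnalytification N.model K 8 ψ) (g : holAutZero N.model N) (hg : orderOf (g : N ≃ₜ N) = 5) :
    {y : N | (g : N ≃ₜ N) y = y}.ncard = 125 ∧ {y : N | (g : N ≃ₜ N) y = y}.Finite := by
  have hKv' := hKv
  obtain ⟨H, Ξ, 𝒜, x₀, j, hH, hHs, hsq⟩ := hKv'
  have hact := HilbertScheme.isTranslationAction_translationAction hH
  -- `g = analyticAut δ₀`, `δ₀ ∈ Aut₀(K)` of order `5`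
  obtain ⟨ψK, hψK⟩ := exists_mulEquiv_autZero_holAutZero hKs hψ
  obtain ⟨δ₀, rfl⟩ := ψK.surjective g
  have hord₀ : orderOf δ₀.val = 5 := by
    rw [Subgroup.orderOf_coe δ₀, ← MulEquiv.orderOf_eq ψK δ₀, ← Subgroup.orderOf_coe, hg]
  have h2 : HodgeTheory.complexBetti.map δ₀.val.hom 2 = 𝟙 _ := δ₀.property
  have hmem : δ₀.val ∈ autFixingH2H3 K :=
    mem_autFixingH2H3_of_trivialOnH2_of_not_orderOf_dvd_two h₂ h₃ hA (by norm_num) hH hHs hsq hKs hact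
      δ₀.val h2 (by rw [hord₀]; norm_num)
  have hγ1 : (⟨δ₀.val, hmem⟩ : autFixingH2H3 K) ≠ 1 := by
    intro h1
    have hv : δ₀.val = 1 := congrArg Subtype.val h1
    have h15 : orderOf δ₀.val = 1 := by rw [hv, orderOf_one]
    omega
  -- a fixed-point scheme of `⟨δ₀⟩` exists and splits into `125` points
  haveI : AlgebraicGeometry.IsProper K.hom := Motives.IsSmoothProjective.isProper_holds hKs
  haveI : Finite (Subgroup.zpowers δ₀.val) :=
    Nat.finite_of_card_ne_zero (by rw [Nat.card_zpowers, hord₀]; norm_num)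
  obtain ⟨F, jF, hF⟩ := exists_isFixedPointScheme (Subgroup.zpowers δ₀.val).subtype
  obtain ⟨x, ⟨hx⟩⟩ := h₁₉ hA hKv hKs ⟨δ₀.val, hmem⟩ hγ1 jF hF
  obtain ⟨hN, -⟩ := Morphisms.natCard_hom_unit_eq_of_isColimit_cofan_fin x hx
  -- … which are the `δ₀`-fixed `ℂ`-points of `K`, i.e. the fixed points of `analyticAut δ₀`
  rw [hF.natCard_points_eq, natCard_fixedPoints_zpowers_eq,
    natCard_unitFixedBy_eq_ncard_fixedPoints_analyticAut hψ, ← hψK δ₀] at hN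
  exact ⟨hN, Set.finite_of_ncard_ne_zero (by rw [hN]; norm_num)⟩

/-- **Binder #19 modulo the IHS-chain hypothesis alone.**  The composition
`hassettTschinkel2013_Oguiso2020_fixedPointScheme_translation_kum4Type_of_ihsChains` with its
Kummer-end hypothesis (d) DISCHARGED by `ncard_fixedPoints_holAutZero_generalizedKummerFour_of_pieces`:
binder #19 `HassettTschinkel2013_Oguiso2020_fixedPointScheme_translation_kum4Type` follows from the
Hassett–Tschinkel fact, Floccari–Varesco `Γ ≅ (ℤ/5)⁴`, Oguiso Prop. 3.6 on `K⁴(A)` (scheme form),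
BNWS Cor. 3.3 (2) and Foster's `H³`-triviality — all NAMED tree records — and the IHS-chain reading of
"`X` is a deformation of `K⁴(A)`" (the rider `H0`, shared with binder #4).
[cite: HassettTschinkel2013, §2 Thm. 2.1 and p. 6] [cite: Oguiso2020CohomologicallyTrivialKummer, §3 Prop. 3.5–3.6 and Thm. 1.2]
[cite: BoissiereNieperWisskirchenSarti2011, §3 Cor. 3.3 (2)] [cite: Foster2024, §3 Cor. 3.5]
[cite: FloccariVaresco2024, §3 first paragraph] [cite: ConradGabberPrasad2015, Prop. A.8.10(1)–(2)]
[cite: SerreGAGA1956, §2 Prop. 2 and §3 n°20] -/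
theorem hassettTschinkel2013_Oguiso2020_fixedPointScheme_translation_kum4Type_of_ihsChains_of_pieces
    (h : Literature.Geometry.Hyperkaehler.HassettTschinkel2013_holAutZero_localSystem.{0})
    (hFV : FloccariVaresco2024_autFixingH2H3_equiv_kumType)
    (h₁₉ : Oguiso2020_fixedPointScheme_translation_generalizedKummerFour)
    (h₂ : Foster2024_kummerTranslation_trivialOnH3) (h₃ : BNWS2011_autTrivialOnH2_generalizedKummer)
    (hchain : ∀ ⦃X : SchemeOver ℂ⦄, IsSmoothProjective 8 X → IsOfGeneralizedKummerType 4 X →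
      ∃ (A : Motives.AbelianVariety ℂ) (K : SchemeOver ℂ), A.dim = 2 ∧
        IsGeneralizedKummerVarietyOf 4 A K ∧ IsSmoothProjective 8 K ∧
        ∃ (M N : ComplexManifold.{0}) (φ : M → ComplexPoints X) (ψ : N → ComplexPoints K),
          IsAnalytification M.model X 8 φ ∧ IsAnalytification N.model K 8 ψ ∧
          Relation.EqvGen (fun X Y : ComplexManifold.{0} =>
            ∃ (𝒴 C : ComplexManifold.{0}) (ϖ : 𝒴 → C) (s t : C) (ι : X → 𝒴) (κ : Y → 𝒴),
              T2Space 𝒴 ∧ SecondCountableTopology 𝒴 ∧ T2Space C ∧ SecondCountableTopology C ∧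
                ConnectedSpace C ∧ IsProperHolomorphicSubmersion 𝒴.model C.model ϖ ∧
                IsFibreEmbedding X.model 𝒴.model ϖ s ι ∧ IsFibreEmbedding Y.model 𝒴.model ϖ t κ ∧
                ∀ c : C, ∃ (Z : ComplexManifold.{0}) (μ : Z → 𝒴),
                  IsFibreEmbedding Z.model 𝒴.model ϖ c μ ∧ Z.IsIrreducibleSymplectic) M N) :
    HassettTschinkel2013_Oguiso2020_fixedPointScheme_translation_kum4Type :=
  hassettTschinkel2013_Oguiso2020_fixedPointScheme_translation_kum4Type_of_ihsChains h hFV hchain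
    (fun _ _ hA hKv hKs N ψ hψ g hg =>
      ncard_fixedPoints_holAutZero_generalizedKummerFour_of_pieces h₁₉ h₂ h₃ hA hKv hKs N ψ hψ g hg)

end Literature.AlgebraicGeometry.Hyperkaehler

end
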